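import Literature.NumberTheory.EllipticCurves.LatticeInclusionRationalProofs
import Literature.NumberTheory.EllipticCurves.WeierstrassPDiffEqProofs
import Literature.FieldTheory.AlgClosed.AutomorphismExtension
import HarnessLib

/-!
# Rigidity of lattice inclusions under `Aut(ℂ)`, and rationality of `g₂, g₃`

Topic `NumberTheory/EllipticCurves`; a proofs-only file (theorems only, no definitions, no named
facts) in `namespace PeriodPair` (deliberate dot-notation extensions of Mathlib's `PeriodPair`).

For lattices `Λ ⊆ Λ'` the sibling `LatticeInclusionRationalProofs.lean` writes `℘_{Λ'} = T(℘_Λ)`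
with `T = P/Q ∈ ℂ(X)` and derives the **algebraic certificate of the inclusion**

  `(P′Q − PQ′)² · (4X³ − g₂X − g₃) = Q · (4P³ − g₂′PQ² − g₃′Q³)`    (∗)

(`g = (g₂, g₃)` the invariants of `Λ`, `g′` those of `Λ'`). This file proves the **converse**:
if `P/Q` is non-constant and (∗) holds for the invariants of two lattices `Λ, Λ'`, then `Λ ⊆ Λ'`
— because `w = T(℘_Λ)` then solves `w′² = 4w³ − g₂′w − g₃′`, so `w = ℘_{Λ'}(±z + c)` by the
uniqueness theorem for the Weierstrass equation (Whittaker–Watson §20.22; the tree's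
`PeriodPair.exists_eq_weierstrassP_of_deriv_sq`, `WeierstrassPDiffEqProofs.lean`), and the
`Λ`-periodicity of `w` makes every `λ ∈ Λ` a period of `℘_{Λ'}`, i.e. `λ ∈ Λ'`.

Since (∗) is an identity between polynomials whose coefficients are built from those of `P, Q`
and `g, g′`, it is **transported by every field automorphism `σ` of `ℂ`**: if `Λ ⊆ Λ'`, then
`Λ^σ ⊆ Λ'^σ` for the lattices `Λ^σ`, `Λ'^σ` with invariants `σ(g)`, `σ(g′)` (which exist by the
uniformisation theorem, the tree's `PeriodPair.uniformization_holds`) — `lattice_le_of_le_map`.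
Consequently (`ratCast_g₂_g₃_of_forall_le`): **if a lattice `Λ` is contained in `Λ^σ` for every
`σ ∈ Aut(ℂ)`, then `Λ = Λ^σ` for all `σ` and `g₂(Λ), g₃(Λ) ∈ ℚ`** (a complex number fixed by
all of `Aut(ℂ)` is rational: the tree's `AutomorphismExtension.lean`, Cox, *Primes of the form
x² + ny²*, proof of Thm. 10.23). This is the lattice-theoretic skeleton of the classical descent
argument "`σ` was an arbitrary automorphism of `ℂ`" (Cox loc. cit.; Shimura, *Introduction to the
arithmetic theory of automorphic functions*, §6.8–§7 for curves attached to modular forms), here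
isolated from its modular-form input: for the period lattice `Λ_f` of a newform with rational
coefficients, the inclusions `Λ_f ⊆ Λ_f^σ` come from the `Γ₀(N)`-invariance of
`℘_{Λ_f^σ} ∘ (2πi ∫ f)`, and the conclusion is the rationality of the invariants of `Λ_f`
(equivalently: `ℂ/Λ_f` is the curve `y² = 4x³ − g₂x − g₃` over `ℚ` whose analytic modular
parametrisation has Manin constant `1`).

## Main statements

* `PeriodPair.not_eventually_const_weierstrassP` — `℘` is nowhere locally constant off `Λ`.
* `PeriodPair.lattice_le_of_transformation_polynomial_identity` — (∗) with `P/Q` non-constant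
  implies `Λ ⊆ Λ'`.
* `PeriodPair.lattice_le_of_le_map` — transport of inclusions along `σ : ℂ ≃+* ℂ`.
* `Literature.NumberTheory.EllipticCurves.exists_ratCast_eq_of_forall_ringEquiv` — a complex
  number fixed by every automorphism of `ℂ` is rational.
* `PeriodPair.lattice_eq_of_forall_le`, `PeriodPair.ratCast_g₂_g₃_of_forall_le` — the rigidity
  theorem and the rationality of `g₂, g₃`.

## References

* E. T. Whittaker, G. N. Watson, *A Course of Modern Analysis*, 4th ed., Cambridge 1927: §20.22.
  [WhittakerWatson1927]
* D. A. Cox, *Primes of the form x² + ny²*, 2nd ed., Wiley 2013: §10.C, proof of Thm. 10.23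
  (the `Aut(ℂ)` argument), Prop. 14.9. [Cox2013]
* J. H. Silverman, *The Arithmetic of Elliptic Curves*, 2nd ed., GTM 106, Springer 2009:
  Thm. VI.4.1, Thm. VI.5.1. [SilvermanAEC2009]
-/

noncomputable section

open Complex Set Polynomial Filter Topology
open Literature.NumberTheory.EllipticCurves Literature.FieldTheory.AlgClosed

namespace PeriodPair

variable (L L' : PeriodPair)

/-! ### `℘` is nowhere locally constant; images of co-countable sets under `℘` are infinite -/

/-- `℘_Λ` is not constant near any point `z₀ ∉ Λ` (identity theorem on the connected set `ℂ ∖ Λ`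
and surjectivity of `℘`, `exists_weierstrassP_eq`). [folklore] -/
theorem not_eventually_const_weierstrassP {z₀ : ℂ} (hz₀ : z₀ ∉ L.lattice) (k : ℂ) :
    ¬ ∀ᶠ z in 𝓝 z₀, ℘[L] z = k := by
  intro h
  have hU : IsPreconnected ((L.lattice : Set ℂ)ᶜ) := by
    simpa [compl_eq_univ_sdiff] using
      isPreconnected_diff_of_countable (C := univ) convex_univ isOpen_univ L.countable_lattice
  have han : AnalyticOnNhd ℂ (fun z ↦ ℘[L] z - k) (L.lattice : Set ℂ)ᶜ := fun z hz ↦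
    (L.analyticOnNhd_weierstrassP z hz).sub analyticAt_const
  have hzero : EqOn (fun z ↦ ℘[L] z - k) 0 (L.lattice : Set ℂ)ᶜ :=
    han.eqOn_zero_of_preconnected_of_eventuallyEq_zero hU hz₀
      (by filter_upwards [h] with z hz; simp [hz])
  obtain ⟨z, hz, hzk⟩ := L.exists_weierstrassP_eq (k + 1)
  have := hzero hz
  simp [hzk] at this

/-- If `T ⊆ ℂ` has countable complement then `℘_Λ(T)` is infinite: its complement lies in
`℘_Λ(ℂ ∖ (Λ ∪ T))`, since `℘_Λ` is onto `ℂ` (`exists_weierstrassP_eq`). [folklore] -/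
theorem infinite_image_weierstrassP {T : Set ℂ} (hT : Tᶜ.Countable) : (℘[L] '' T).Infinite := by
  intro hfin
  have hsub : (℘[L] '' T)ᶜ ⊆ ℘[L] '' Tᶜ := by
    intro x hx
    obtain ⟨z, -, rfl⟩ := L.exists_weierstrassP_eq x
    exact ⟨z, fun hzT ↦ hx ⟨z, hzT, rfl⟩, rfl⟩
  have h1 : ((℘[L] '' T)ᶜ).Countable := (hT.image _).mono hsub
  exact not_countable_complex (by simpa using hfin.countable.union h1)

/-! ### From the polynomial identity to the inclusion of lattices -/

/-- The differential equation of `w = (P/Q)(℘_Λ)` from the polynomial identity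
`(P′Q − PQ′)²·(4X³ − g₂X − g₃) = Q·(4P³ − g₂′PQ² − g₃′Q³)`: at every `z ∉ Λ` with
`Q(℘_Λ z) ≠ 0`, `w′(z)² = 4w(z)³ − g₂′w(z) − g₃′` (chain rule and `℘′² = 4℘³ − g₂℘ − g₃`).
[folklore] -/
theorem deriv_sq_eq_of_transformation_polynomial_identity {P Q : ℂ[X]}
    (hid : (derivative P * Q - P * derivative Q) ^ 2 * (4 * X ^ 3 - C L.g₂ * X - C L.g₃) =
      Q * (4 * P ^ 3 - C L'.g₂ * P * Q ^ 2 - C L'.g₃ * Q ^ 3))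
    {z : ℂ} (hz : z ∉ L.lattice) (hq : Q.eval (℘[L] z) ≠ 0) :
    deriv (fun y ↦ P.eval (℘[L] y) / Q.eval (℘[L] y)) z ^ 2 =
      4 * (P.eval (℘[L] z) / Q.eval (℘[L] z)) ^ 3 - L'.g₂ * (P.eval (℘[L] z) / Q.eval (℘[L] z)) -
        L'.g₃ := by
  have hdP : HasDerivAt (fun w ↦ P.eval (℘[L] w))
      ((derivative P).eval (℘[L] z) * ℘'[L] z) z :=
    (P.hasDerivAt (℘[L] z)).comp z (L.hasDerivAt_weierstrassP hz)
  have hdQ : HasDerivAt (fun w ↦ Q.eval (℘[L] w))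
      ((derivative Q).eval (℘[L] z) * ℘'[L] z) z :=
    (Q.hasDerivAt (℘[L] z)).comp z (L.hasDerivAt_weierstrassP hz)
  have hderiv : deriv (fun y ↦ P.eval (℘[L] y) / Q.eval (℘[L] y)) z =
      ((derivative P).eval (℘[L] z) * ℘'[L] z * Q.eval (℘[L] z) -
        P.eval (℘[L] z) * ((derivative Q).eval (℘[L] z) * ℘'[L] z)) / Q.eval (℘[L] z) ^ 2 :=
    (hdP.div hdQ hq).deriv
  rw [hderiv]
  have E3 := L.derivWeierstrassP_sq z hz
  have hidx := congrArg (Polynomial.eval (℘[L] z)) hid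
  simp only [eval_mul, eval_pow, eval_sub, eval_X, eval_C, eval_ofNat] at hidx
  set x := ℘[L] z
  set y := ℘'[L] z
  set p := P.eval x
  set q := Q.eval x
  set p' := (derivative P).eval x
  set q' := (derivative Q).eval x
  rw [show ((p' * y * q - p * (q' * y)) / q ^ 2) ^ 2 = (y * (p' * q - p * q')) ^ 2 / q ^ 4 by ring,
    show 4 * (p / q) ^ 3 - L'.g₂ * (p / q) - L'.g₃ =
      (4 * p ^ 3 - L'.g₂ * p * q ^ 2 - L'.g₃ * q ^ 3) / q ^ 3 by field_simp,
    div_eq_div_iff (pow_ne_zero 4 hq) (pow_ne_zero 3 hq)]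
  linear_combination (p' * q - p * q') ^ 2 * q ^ 3 * E3 + q ^ 3 * hidx

/-- **Periodicity read through `℘_{Λ'}` gives the inclusion.** Let `V ⊆ ℂ` be open with countable
complement, `w : ℂ → ℂ` a function with `w(z + λ) = w(z)` whenever `λ ∈ Λ` and `z, z + λ ∈ V`, and
suppose `w(z) = ℘_{Λ'}(εz + c)` for all `z ∈ V` with `εz + c ∉ Λ'`, where `ε = ±1`. Then
`Λ ⊆ Λ'`: for `λ ∈ Λ` and a generic `z₁` (off four countable sets) the identity
`℘_{Λ'}(ελ + ζ) = ℘_{Λ'}(ζ)` holds for `ζ = εz + c`, `z` near `z₁`, and a translation symmetry of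
`℘_{Λ'}` along a non-constant curve is a period (`mem_lattice_of_weierstrassP_comp_add_eventuallyEq`).
[folklore] -/
theorem lattice_le_of_periodic_of_eq_weierstrassP {V : Set ℂ} (hVo : IsOpen V)
    (hVcompl : Vᶜ.Countable) {w : ℂ → ℂ}
    (hper : ∀ l ∈ L.lattice, ∀ z ∈ V, z + l ∈ V → w (z + l) = w z) {ε c : ℂ}
    (hε : ε = 1 ∨ ε = -1)
    (hglob : ∀ z ∈ V, ε * z + c ∉ L'.lattice → w z = ℘[L'] (ε * z + c)) :
    L.lattice ≤ L'.lattice := by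
  have hε0 : ε ≠ 0 := by rcases hε with rfl | rfl <;> norm_num
  intro l hl
  -- a good base point `z₁`, off four countable sets
  have hbad : ({z | z ∉ V} ∪ {z | z + l ∉ V} ∪ {z | ε * z + c ∈ L'.lattice} ∪
      {z | ε * (z + l) + c ∈ L'.lattice}).Countable := by
    refine ((Set.Countable.union ?_ ?_).union ?_).union ?_
    · exact hVcompl
    · have : {z : ℂ | z + l ∉ V} = (fun z ↦ z - l) '' Vᶜ := by
        ext z
        simp only [mem_setOf_eq, mem_image, mem_compl_iff]
        constructor
        · intro h
          exact ⟨z + l, h, by ring⟩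
        · rintro ⟨y, hy, rfl⟩
          simpa using hy
      rw [this]
      exact hVcompl.image _
    · have : {z : ℂ | ε * z + c ∈ L'.lattice} ⊆
          (fun m ↦ ε * (m - c)) '' (L'.lattice : Set ℂ) := by
        intro z hz
        refine ⟨ε * z + c, hz, ?_⟩
        rcases hε with rfl | rfl <;> ring
      exact (L'.countable_lattice.image _).mono this
    · have : {z : ℂ | ε * (z + l) + c ∈ L'.lattice} ⊆
          (fun m ↦ ε * (m - c) - l) '' (L'.lattice : Set ℂ) := by
        intro z hz
        refine ⟨ε * (z + l) + c, hz, ?_⟩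
        rcases hε with rfl | rfl <;> ring
      exact (L'.countable_lattice.image _).mono this
  obtain ⟨z₁, hz₁⟩ : ({z | z ∉ V} ∪ {z | z + l ∉ V} ∪ {z | ε * z + c ∈ L'.lattice} ∪
      {z | ε * (z + l) + c ∈ L'.lattice})ᶜ.Nonempty := by
    by_contra hne
    rw [not_nonempty_iff_eq_empty, compl_empty_iff] at hne
    exact not_countable_complex (hne ▸ hbad)
  have hz₁V : z₁ ∈ V := by
    by_contra h; exact hz₁ (Or.inl (Or.inl (Or.inl h)))
  have hz₁lV : z₁ + l ∈ V := by
    by_contra h; exact hz₁ (Or.inl (Or.inl (Or.inr h)))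
  have hz₁c : ε * z₁ + c ∉ L'.lattice := fun h ↦ hz₁ (Or.inl (Or.inr h))
  have hz₁lc : ε * (z₁ + l) + c ∉ L'.lattice := fun h ↦ hz₁ (Or.inr h)
  -- the identity `℘_{Λ'}(εl + ζ(z)) = ℘_{Λ'}(ζ(z))` near `z₁`
  have hΛ'o : IsOpen ((L'.lattice : Set ℂ)ᶜ) := L'.isClosed_lattice.isOpen_compl
  have ev1 : ∀ᶠ z in 𝓝 z₁, z ∈ V := hVo.mem_nhds hz₁V
  have ev2 : ∀ᶠ z in 𝓝 z₁, z + l ∈ V :=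
    (continuous_id.add continuous_const).continuousAt.preimage_mem_nhds (hVo.mem_nhds hz₁lV)
  have ev3 : ∀ᶠ z in 𝓝 z₁, ε * z + c ∉ L'.lattice :=
    (by fun_prop : Continuous fun z : ℂ ↦ ε * z + c).continuousAt.preimage_mem_nhds
      (hΛ'o.mem_nhds hz₁c)
  have ev4 : ∀ᶠ z in 𝓝 z₁, ε * (z + l) + c ∉ L'.lattice :=
    (by fun_prop : Continuous fun z : ℂ ↦ ε * (z + l) + c).continuousAt.preimage_mem_nhds
      (hΛ'o.mem_nhds hz₁lc)
  have hperiod : ∀ᶠ z in 𝓝 z₁, ℘[L'] (ε * l + (ε * z + c)) = ℘[L'] (ε * z + c) := by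
    filter_upwards [ev1, ev2, ev3, ev4] with z h1 h2 h3 h4
    rw [show ε * l + (ε * z + c) = ε * (z + l) + c by ring, ← hglob (z + l) h2 h4,
      hper l hl z h1 h2, hglob z h1 h3]
  have hζ : AnalyticAt ℂ (fun z : ℂ ↦ ε * z + c) z₁ := by fun_prop
  have hζnc : ¬ ∀ᶠ z in 𝓝 z₁, ε * z + c = ε * z₁ + c := by
    intro h
    obtain ⟨r, hr, hball⟩ := Metric.mem_nhds_iff.1 h
    have hmem : z₁ + (r / 2 : ℝ) ∈ Metric.ball z₁ r := by
      rw [Metric.mem_ball, dist_self_add_left, Complex.norm_real, Real.norm_eq_abs,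
        abs_of_pos (half_pos hr)]
      exact half_lt_self hr
    have h1 : ε * (z₁ + (r / 2 : ℝ)) + c = ε * z₁ + c := hball hmem
    have h2 : ε * ((r / 2 : ℝ) : ℂ) = 0 := by linear_combination h1
    rcases mul_eq_zero.mp h2 with h3 | h3
    · exact hε0 h3
    · have : (r / 2 : ℝ) = 0 := by exact_mod_cast h3
      linarith
  have hmem := L'.mem_lattice_of_weierstrassP_comp_add_eventuallyEq hζ hζnc hz₁c
    (by rw [show ε * l + (ε * z₁ + c) = ε * (z₁ + l) + c by ring]; exact hz₁lc) hperiod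
  rcases hε with rfl | rfl
  · simpa using hmem
  · simpa using neg_mem hmem

/-- **The algebraic certificate implies the inclusion.** Let `P, Q ∈ ℂ[X]`, `Q ≠ 0`, `P/Q` not
constant, and suppose `(P′Q − PQ′)²·(4X³ − g₂X − g₃) = Q·(4P³ − g₂′PQ² − g₃′Q³)` for the
invariants `g₂, g₃` of `Λ` and `g₂′, g₃′` of `Λ'`. Then `Λ ⊆ Λ'`. Indeed `w = (P/Q)(℘_Λ)` is
holomorphic and `Λ`-periodic on `V = ℂ ∖ (Λ ∪ {Q(℘_Λ) = 0})` (a co-countable open set) and the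
identity gives `w′² = 4w³ − g₂′w − g₃′` there
(`deriv_sq_eq_of_transformation_polynomial_identity`); `w` is not a constant root of the cubic
(else `P/Q` would be constant, `℘_Λ(V)` being infinite), so `w = ℘_{Λ'}(εz + c)` on `V` off a
countable set (`exists_eq_weierstrassP_of_deriv_sq`, Whittaker–Watson §20.22), and periodicity
gives the inclusion (`lattice_le_of_periodic_of_eq_weierstrassP`).
[cite: WhittakerWatson1927, §20.22] -/
theorem lattice_le_of_transformation_polynomial_identity {P Q : ℂ[X]} (hQ : Q ≠ 0)
    (hnc : ∀ k : ℂ, P ≠ C k * Q)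
    (hid : (derivative P * Q - P * derivative Q) ^ 2 * (4 * X ^ 3 - C L.g₂ * X - C L.g₃) =
      Q * (4 * P ^ 3 - C L'.g₂ * P * Q ^ 2 - C L'.g₃ * Q ^ 3)) :
    L.lattice ≤ L'.lattice := by
  classical
  -- the domain `V` and its basic properties
  set V : Set ℂ := {z | z ∉ L.lattice ∧ Q.eval (℘[L] z) ≠ 0} with hV
  have hΛo : IsOpen ((L.lattice : Set ℂ)ᶜ) := L.isClosed_lattice.isOpen_compl
  have hΛpre : IsPreconnected ((L.lattice : Set ℂ)ᶜ) := by
    simpa [compl_eq_univ_sdiff] using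
      isPreconnected_diff_of_countable (C := univ) convex_univ isOpen_univ L.countable_lattice
  have hΛconn : IsConnected ((L.lattice : Set ℂ)ᶜ) :=
    ⟨⟨L.ω₁ / 2, L.ω₁_div_two_notMem_lattice⟩, hΛpre⟩
  have hVo : IsOpen V := by
    have hVeq : V = (L.lattice : Set ℂ)ᶜ ∩ ℘[L] ⁻¹' ((fun x ↦ Q.eval x) ⁻¹' {0}ᶜ) := by
      ext z; simp [hV]
    rw [hVeq]
    exact L.differentiableOn_weierstrassP.continuousOn.isOpen_inter_preimage hΛo
      (isOpen_compl_singleton.preimage Q.continuous)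
  have hcount : (univ \ V).Countable := by
    have hsub : univ \ V ⊆ (L.lattice : Set ℂ) ∪
        ⋃ r ∈ (Q.roots.toFinset : Set ℂ), ((L.lattice : Set ℂ)ᶜ ∩ ℘[L] ⁻¹' {r}) := by
      intro z hz
      by_cases hzΛ : z ∈ L.lattice
      · exact Or.inl hzΛ
      · right
        have hr : Q.eval (℘[L] z) = 0 := by
          by_contra hne
          exact hz.2 ⟨hzΛ, hne⟩
        simp only [mem_iUnion, mem_inter_iff, mem_compl_iff, mem_preimage, mem_singleton_iff,
          exists_prop, Finset.mem_coe, Multiset.mem_toFinset]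
        exact ⟨℘[L] z, (mem_roots hQ).mpr hr, hzΛ, rfl⟩
    refine Countable.mono hsub (L.countable_lattice.union ?_)
    refine (Finset.countable_toSet _).biUnion fun r _ ↦ ?_
    obtain ⟨z₁, hz₁, hz₁r⟩ := L.exists_weierstrassP_eq (r + 1)
    exact countable_inter_preimage_singleton_of_analyticOnNhd L.analyticOnNhd_weierstrassP hΛconn
      hz₁ (by rw [hz₁r]; simp)
  have hVcompl : Vᶜ.Countable := by simpa [compl_eq_univ_sdiff] using hcount
  -- the function `w = (P/Q)(℘)` on `V`
  set w : ℂ → ℂ := fun z ↦ P.eval (℘[L] z) / Q.eval (℘[L] z) with hw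
  have hPa : ∀ x, AnalyticAt ℂ (fun x ↦ P.eval x) x := fun x ↦ P.differentiable.analyticAt x
  have hQa : ∀ x, AnalyticAt ℂ (fun x ↦ Q.eval x) x := fun x ↦ Q.differentiable.analyticAt x
  have hwan : AnalyticOnNhd ℂ w V := fun z hz ↦
    ((hPa _).comp (L.analyticOnNhd_weierstrassP z hz.1)).div
      ((hQa _).comp (L.analyticOnNhd_weierstrassP z hz.1)) hz.2
  have hvan : AnalyticOnNhd ℂ (fun z : ℂ ↦ z) V := fun z _ ↦ analyticAt_id
  -- the differential equation on `V`
  have hode : ∀ z ∈ V, deriv w z ^ 2 =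
      deriv (fun z : ℂ ↦ z) z ^ 2 * (4 * w z ^ 3 - L'.g₂ * w z - L'.g₃) := by
    intro z hz
    rw [deriv_id'', one_pow, one_mul]
    exact L.deriv_sq_eq_of_transformation_polynomial_identity L' hid hz.1 hz.2
  -- `w` is not a constant root of the cubic
  have hVne : V.Nonempty := by
    by_contra hVe
    rw [not_nonempty_iff_eq_empty] at hVe
    exact not_countable_complex (by simpa [hVe] using hVcompl)
  have hex : ∃ z₀ ∈ V, 4 * w z₀ ^ 3 - L'.g₂ * w z₀ - L'.g₃ ≠ 0 := by
    by_contra! hall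
    -- `w` maps the preconnected `V` into the finite root set of the cubic, so it is constant
    set R : ℂ[X] := 4 * X ^ 3 - C L'.g₂ * X - C L'.g₃ with hR
    have hR3 : R.coeff 3 = 4 := by
      simp [hR]
    have hR0 : R ≠ 0 := by
      intro h0
      rw [h0, coeff_zero] at hR3
      norm_num at hR3
    have hmaps : MapsTo w V (R.roots.toFinset : Set ℂ) := by
      intro z hz
      rw [Finset.mem_coe, Multiset.mem_toFinset, mem_roots hR0, IsRoot.def]
      simp only [hR, eval_sub, eval_mul, eval_pow, eval_X, eval_C, eval_ofNat]
      exact hall z hz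
    have hVpre : IsPreconnected V := by
      simpa [compl_eq_univ_sdiff] using
        isPreconnected_diff_of_countable (C := univ) convex_univ isOpen_univ hcount
    obtain ⟨z₁, hz₁⟩ := hVne
    have hconst : ∀ z ∈ V, w z = w z₁ := fun z hz ↦
      hVpre.constant_of_mapsTo (Finset.finite_toSet _).isDiscrete hwan.continuousOn hmaps hz hz₁
    -- then `P − w(z₁) Q` vanishes on `℘(V)`, an infinite set
    apply hnc (w z₁)
    have hroots : ℘[L] '' V ⊆ {x | (P - C (w z₁) * Q).IsRoot x} := by
      rintro _ ⟨z, hz, rfl⟩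
      have h1 : P.eval (℘[L] z) / Q.eval (℘[L] z) = w z₁ := hconst z hz
      rw [div_eq_iff hz.2] at h1
      simp only [mem_setOf_eq, IsRoot.def, eval_sub, eval_mul, eval_C]
      rw [h1]
      ring
    have hinf : {x | (P - C (w z₁) * Q).IsRoot x}.Infinite :=
      (L.infinite_image_weierstrassP hVcompl).mono hroots
    exact sub_eq_zero.mp ((P - C (w z₁) * Q).eq_zero_of_infinite_isRoot hinf)
  obtain ⟨z₀, hz₀, h0⟩ := hex
  -- the uniqueness theorem: `w = ℘_{Λ'}(εz + c)`
  obtain ⟨ε, hε, c, -, hglob⟩ := L'.exists_eq_weierstrassP_of_deriv_sq (C := univ) convex_univ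
    isOpen_univ hVo (subset_univ V) hcount hwan hvan hode hz₀ h0
  -- periodicity of `w`
  refine L.lattice_le_of_periodic_of_eq_weierstrassP L' hVo hVcompl (w := w) ?_ hε hglob
  intro l hl z _ _
  simp only [hw, L.weierstrassP_add_coe z ⟨l, hl⟩]

/-! ### Transport of inclusions along automorphisms of `ℂ` -/

/-- **Inclusions of lattices are transported by `Aut(ℂ)` acting on the invariants.** Let
`σ : ℂ ≃+* ℂ`, let `Λ₁ ⊆ Λ₂` be lattices, and let `M₁`, `M₂` be lattices with invariants
`(g₂, g₃)(Mᵢ) = σ((g₂, g₃)(Λᵢ))`. Then `M₁ ⊆ M₂`. Proof: write `℘_{Λ₂} = (P/Q)(℘_{Λ₁})`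
(`exists_polynomial_weierstrassP_mul_eval_eq_of_le`), pass to the polynomial identity
(`transformation_polynomial_identity`), apply `σ` to its coefficients (`Polynomial.map`), and
read the mapped identity backwards for `M₁, M₂` (`lattice_le_of_transformation_polynomial_identity`);
`P/Q` is not constant because `℘_{Λ₂}` is nowhere locally constant. [folklore] -/
theorem lattice_le_of_le_map (σ : ℂ ≃+* ℂ) {L₁ L₂ M₁ M₂ : PeriodPair}
    (h : L₁.lattice ≤ L₂.lattice) (h₁₂ : M₁.g₂ = σ L₁.g₂) (h₁₃ : M₁.g₃ = σ L₁.g₃)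
    (h₂₂ : M₂.g₂ = σ L₂.g₂) (h₂₃ : M₂.g₃ = σ L₂.g₃) : M₁.lattice ≤ M₂.lattice := by
  obtain ⟨P, Q, hQ0, hQ, hPQ⟩ := L₁.exists_polynomial_weierstrassP_mul_eval_eq_of_le L₂ h
  have hid := L₁.transformation_polynomial_identity L₂ h hPQ
  -- `P/Q` is not constant
  have hnc : ∀ k : ℂ, P ≠ C k * Q := by
    intro k hk
    apply L₂.not_eventually_const_weierstrassP L₂.ω₁_div_two_notMem_lattice k
    filter_upwards [L₂.isClosed_lattice.isOpen_compl.mem_nhds L₂.ω₁_div_two_notMem_lattice]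
      with z hz
    have h1 := hPQ z hz
    rw [hk, eval_mul, eval_C] at h1
    exact mul_right_cancel₀ (hQ z hz) (by rw [h1])
  -- map the identity by `σ`
  set f : ℂ →+* ℂ := σ.toRingHom with hf
  have hfinj : Function.Injective f := σ.injective
  have hQσ : Q.map f ≠ 0 := (Polynomial.map_ne_zero_iff hfinj).mpr hQ0
  have hncσ : ∀ k : ℂ, P.map f ≠ C k * Q.map f := by
    intro k hk
    apply hnc (σ.symm k)
    apply Polynomial.map_injective f hfinj
    rw [hk, Polynomial.map_mul, Polynomial.map_C]
    simp [hf]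
  have hidσ := congrArg (Polynomial.map f) hid
  simp only [Polynomial.map_mul, Polynomial.map_sub, Polynomial.map_pow,
    ← Polynomial.derivative_map, Polynomial.map_C, Polynomial.map_X, Polynomial.map_ofNat, hf,
    RingEquiv.toRingHom_eq_coe, RingHom.coe_coe] at hidσ
  rw [← h₁₂, ← h₁₃, ← h₂₂, ← h₂₃] at hidσ
  refine M₁.lattice_le_of_transformation_polynomial_identity M₂ ?_ ?_ hidσ
  · simpa [hf] using hQσ
  · simpa [hf] using hncσ

/-! ### Complex numbers fixed by `Aut(ℂ)` are rational -/

/-- A complex number fixed by every field automorphism of `ℂ` is rational: its `Aut(ℂ)`-orbit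
is `{x}`, so `x` is algebraic with all conjugates equal to `x` (the tree's
`Complex.natDegree_minpoly_le_card`, Cox, proof of Thm. 10.23), i.e. `deg minpoly_ℚ(x) = 1`.
[cite: Cox2013, §10.C proof of Thm. 10.23] -/
theorem _root_.Literature.NumberTheory.EllipticCurves.exists_ratCast_eq_of_forall_ringEquiv
    {x : ℂ} (h : ∀ σ : ℂ ≃+* ℂ, σ x = x) : ∃ q : ℚ, (q : ℂ) = x := by
  classical
  have hmem : ∀ σ : ℂ ≃+* ℂ, σ x ∈ ({x} : Finset ℂ) := fun σ ↦ by simp [h σ]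
  have hint : IsIntegral ℚ x :=
    Complex.isIntegral_of_forall_ringEquiv_mem (Finset.finite_toSet {x}) (by simpa using hmem)
  have hle : (minpoly ℚ x).natDegree ≤ 1 := by
    simpa using Complex.natDegree_minpoly_le_card hmem
  have hge : 0 < (minpoly ℚ x).natDegree := minpoly.natDegree_pos hint
  have hdeg : (minpoly ℚ x).degree = 1 := by
    rw [degree_eq_natDegree (minpoly.ne_zero hint)]
    exact_mod_cast le_antisymm hle hge
  obtain ⟨q, hq⟩ := minpoly.mem_range_of_degree_eq_one ℚ x hdeg
  exact ⟨q, by simpa using hq⟩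

/-! ### Rigidity -/

/-- **Rigidity of a lattice contained in all its conjugates.** Suppose that for every
automorphism `σ` of `ℂ` and every lattice `M` with invariants `(g₂, g₃)(M) = σ((g₂, g₃)(Λ))`
one has `Λ ⊆ M`. Then every such `M` equals `Λ`: applying the hypothesis to `σ⁻¹` gives
`Λ ⊆ Λ^{σ⁻¹}`, which `σ` transports to `Λ^σ = M ⊆ Λ` (`lattice_le_of_le_map`; the lattice
`Λ^{σ⁻¹}` with invariants `σ⁻¹(g)` exists by the uniformisation theorem,
`uniformization_holds`). [folklore] -/
theorem lattice_eq_of_forall_le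
    (hyp : ∀ σ : ℂ ≃+* ℂ, ∀ M : PeriodPair, M.g₂ = σ L.g₂ → M.g₃ = σ L.g₃ →
      L.lattice ≤ M.lattice)
    (σ : ℂ ≃+* ℂ) {M : PeriodPair} (hM₂ : M.g₂ = σ L.g₂) (hM₃ : M.g₃ = σ L.g₃) :
    L.lattice = M.lattice := by
  refine le_antisymm (hyp σ M hM₂ hM₃) ?_
  -- the conjugate lattice for `σ⁻¹`
  have hΔ' : (σ.symm L.g₂) ^ 3 - 27 * (σ.symm L.g₃) ^ 2 ≠ 0 := by
    intro h0
    apply L.discr_ne_zero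
    apply σ.symm.injective
    simpa [map_sub, map_mul, map_pow, map_ofNat] using h0
  obtain ⟨M', hM'₂, hM'₃⟩ := uniformization_holds _ _ hΔ'
  have h2 : L.lattice ≤ M'.lattice := hyp σ.symm M' hM'₂ hM'₃
  exact lattice_le_of_le_map σ h2 hM₂ hM₃ (by simp [hM'₂]) (by simp [hM'₃])

/-- **Rationality of the invariants of a rigid lattice.** Under the hypothesis of
`lattice_eq_of_forall_le` — `Λ ⊆ M` for every `σ ∈ Aut(ℂ)` and every lattice `M` with invariants
`σ(g₂(Λ)), σ(g₃(Λ))` — the invariants `g₂(Λ), g₃(Λ)` are rational numbers: for each `σ` the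
lattice `Λ^σ` exists (`uniformization_holds`) and equals `Λ`, so `σ(gᵢ) = gᵢ(Λ^σ) = gᵢ(Λ)`
(`g₂_eq_of_lattice_eq`), and a complex number fixed by `Aut(ℂ)` is rational
(`exists_ratCast_eq_of_forall_ringEquiv`). For the period lattice of a rational newform this is
the analytic content of the rationality of the Manin constant (Agashe–Ribet–Stein 2006, §2), the
inclusions being supplied by the `Γ₀(N)`-invariance of `℘_{Λ^σ} ∘ (2πi∫f)`. [folklore] -/
theorem ratCast_g₂_g₃_of_forall_le
    (hyp : ∀ σ : ℂ ≃+* ℂ, ∀ M : PeriodPair, M.g₂ = σ L.g₂ → M.g₃ = σ L.g₃ →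
      L.lattice ≤ M.lattice) :
    (∃ q : ℚ, (q : ℂ) = L.g₂) ∧ (∃ q : ℚ, (q : ℂ) = L.g₃) := by
  have hfix : ∀ σ : ℂ ≃+* ℂ, σ L.g₂ = L.g₂ ∧ σ L.g₃ = L.g₃ := by
    intro σ
    have hΔσ : (σ L.g₂) ^ 3 - 27 * (σ L.g₃) ^ 2 ≠ 0 := by
      intro h0
      apply L.discr_ne_zero
      apply σ.injective
      simpa [map_sub, map_mul, map_pow, map_ofNat] using h0
    obtain ⟨M, hM₂, hM₃⟩ := uniformization_holds _ _ hΔσ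
    have heq := L.lattice_eq_of_forall_le hyp σ hM₂ hM₃
    exact ⟨by rw [← hM₂, g₂_eq_of_lattice_eq heq], by rw [← hM₃, g₃_eq_of_lattice_eq heq]⟩
  exact ⟨exists_ratCast_eq_of_forall_ringEquiv fun σ ↦ (hfix σ).1,
    exists_ratCast_eq_of_forall_ringEquiv fun σ ↦ (hfix σ).2⟩

end PeriodPair

end
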